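import Summits.CriticalPhenomena.SAWScalingLimit.Theorems.SAWDefectDecoherencePolygonParitySqueezeDefs
import Summits.CriticalPhenomena.SAWScalingLimit.Theorems.SAWDefectDecoherenceBoundaryClosureRGateMassLaws
import Literature.Probability.LatticeModels.HexStarDirections
import HarnessLib

/-!
# Crux `BoundaryClosureR` (stmt-CriticalPhenomena-14004), line `polygon-parity-squeeze`:
# the six exact zigzag half-lattices have dangling edges of ONE class

Lattice fact on which the TAME CARRIERS of the line rest (skeleton
`Cruxes/BoundaryClosureR/Lines/polygon_parity_squeeze.lean`, mechanism (A); vocabulary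
`Theorems/SAWDefectDecoherencePolygonParitySqueezeDefs.lean`: `zigzagForm`, `innerNormal`,
`halfPlane`).  For each of the six forms `k : Fin 6` (`row`, `−row`, `col`, `−col`,
`col + row + type`, `−(col + row + type)`) and every threshold `n`, EVERY edge `{v, w}` of the
honeycomb lattice `ℍ` leaving the exact half-lattice `{v | n ≤ zigzagForm k v}` (`v` inside, `w`
outside) has the same embedded direction, the outward normal scaled to the edge length `1/√3`:

  `hexCenter w - hexCenter v = -(1/√3) · innerNormal k`      (`zigzag_dangling_direction`).

Consequently every boundary mid-edge hanging from an exact zigzag side carries ONE rigid phase (the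
Duminil-Copin–Smirnov winding factor is constant along the side).  The proof is a finite check on
the embedded lattice: `v = (x, t)`, `w` one of its three neighbours
(`hexGraph_adj_iff_of_snd_eq_zero_holds`, `hexGraph_adj_iff_of_snd_eq_one`), six forms; in `30` of
the `36` cases the two threshold conditions contradict each other (`omega`), in the remaining six
the centre difference is computed in real and imaginary parts (`hexCenter_sub_up/down`,
`neg_inv_sqrt_three_mul_innerNormal`).

Also recorded (cheap dictionary entries used by the line): the closed forms of the six inner
normals (`innerNormal_eq`), `halfPlane 0 z = {w | z.im < w.im}` and `halfPlane 1 z = {w | w.im < z.im}`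
(so the pins of `AdmissibleFamily` / `PinnedFlatRoot` are flat sides of form `0`), and the
row/height dictionary of form `0` in the `innerNormal` frame (`zigzagForm_zero_le_iff`, from the
landed `GateMass.row_le_iff_lt_im`).
-/

noncomputable section

open scoped ComplexConjugate
open Literature.Probability.LatticeModels

namespace Summit.CriticalPhenomena.SAWScalingLimit.Theorems.PolygonParitySqueeze

/-! ### 1. The six inner normals in closed form -/

/-- `e^{-iπ/6} = √3/2 - i/2`. [folklore] -/
theorem exp_neg_pi_div_six_mul_I :
    Complex.exp (-((Real.pi / 6 : ℝ) : ℂ) * Complex.I) = ⟨Real.sqrt 3 / 2, -(1 / 2)⟩ := by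
  rw [← Complex.ofReal_neg]
  apply Complex.ext
  · rw [Complex.exp_ofReal_mul_I_re, Real.cos_neg, Real.cos_pi_div_six]
  · rw [Complex.exp_ofReal_mul_I_im, Real.sin_neg, Real.sin_pi_div_six]

/-- `e^{iπ/6} = √3/2 + i/2`. [folklore] -/
theorem exp_pi_div_six_mul_I :
    Complex.exp (((Real.pi / 6 : ℝ) : ℂ) * Complex.I) = ⟨Real.sqrt 3 / 2, 1 / 2⟩ := by
  apply Complex.ext
  · rw [Complex.exp_ofReal_mul_I_re, Real.cos_pi_div_six]
  · rw [Complex.exp_ofReal_mul_I_im, Real.sin_pi_div_six]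

/-- **The six inner normals in closed form**: `i, −i, √3/2 − i/2, −(√3/2 − i/2), √3/2 + i/2,
−(√3/2 + i/2)`. [folklore] -/
theorem innerNormal_eq : innerNormal = ![Complex.I, -Complex.I, ⟨Real.sqrt 3 / 2, -(1 / 2)⟩,
    -⟨Real.sqrt 3 / 2, -(1 / 2)⟩, ⟨Real.sqrt 3 / 2, 1 / 2⟩, -⟨Real.sqrt 3 / 2, 1 / 2⟩] := by
  rw [innerNormal, exp_neg_pi_div_six_mul_I, exp_pi_div_six_mul_I]

/-- **The six dangling directions** `-(1/√3)·innerNormal k` in real and imaginary parts: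
`−i/√3, i/√3, −1/2 + i√3/6, 1/2 − i√3/6, −1/2 − i√3/6, 1/2 + i√3/6` (arguments −90°, +90°, 150°,
−30°, −150°, +30°). [folklore] -/
theorem neg_inv_sqrt_three_mul_innerNormal (k : Fin 6) :
    -(((Real.sqrt 3)⁻¹ : ℝ) : ℂ) * innerNormal k =
      ![⟨0, -(Real.sqrt 3 / 3)⟩, ⟨0, Real.sqrt 3 / 3⟩, ⟨-(1 / 2), Real.sqrt 3 / 6⟩,
        ⟨1 / 2, -(Real.sqrt 3 / 6)⟩, ⟨-(1 / 2), -(Real.sqrt 3 / 6)⟩, ⟨1 / 2, Real.sqrt 3 / 6⟩] k := by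
  have h3 : Real.sqrt 3 * Real.sqrt 3 = 3 := Real.mul_self_sqrt (by norm_num)
  have hinv : (Real.sqrt 3)⁻¹ = Real.sqrt 3 / 3 := by
    rw [← Real.sqrt_div_self]
  fin_cases k <;> apply Complex.ext <;>
    simp [innerNormal_eq, hinv] <;> nlinarith [h3]

/-! ### 2. Half-planes and the row dictionary of form `0` -/

/-- The half-plane of form `0` through `z` is the open upper half-plane above `z`: the pins of
`AdmissibleFamily` (`{z | (pt 1).im < z.im}`) and `PinnedFlatRoot` are flat sides of form `0`.
[folklore] -/
theorem halfPlane_zero (z : ℂ) : halfPlane 0 z = {w : ℂ | z.im < w.im} := by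
  ext w
  simp [halfPlane, innerNormal_eq, sub_pos]

/-- The half-plane of form `1` through `z` is the open lower half-plane below `z`. [folklore] -/
theorem halfPlane_one (z : ℂ) : halfPlane 1 z = {w : ℂ | w.im < z.im} := by
  ext w
  simp [halfPlane, innerNormal_eq]

/-- In the frame of form `0`, `Re(c_v · conj n₀) = Im c_v`. [folklore] -/
theorem re_hexCenter_mul_conj_innerNormal_zero (v : HexVertex) :
    (hexCenter v * conj (innerNormal 0)).re = (hexCenter v).im := by
  simp [innerNormal_eq]

/-- **Row/height dictionary of form `0`** (monotonicity of the form in `Re(c_v · conj n₀)`): a face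
lies in the exact half-lattice `{v | n ≤ zigzagForm 0 v} = {v | n ≤ v.1 1}` iff
`n·√3/2 < Re(c_v · conj n₀) = Im c_v` (the landed `GateMass.row_le_iff_lt_im`). [folklore] -/
theorem zigzagForm_zero_le_iff (n : ℤ) (v : HexVertex) :
    n ≤ zigzagForm 0 v ↔ (n : ℝ) * (Real.sqrt 3 / 2) < (hexCenter v * conj (innerNormal 0)).re := by
  rw [re_hexCenter_mul_conj_innerNormal_zero]
  exact PickHalfPlane.GateMass.row_le_iff_lt_im n v

/-! ### 3. The three edge vectors at an up face and at a down face -/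

/-- **Edge vectors at an up face** `(x; 0)`, in real and imaginary parts: towards `(x; 1)`,
`(x − e₀; 1)`, `(x − e₁; 1)` they are `1/2 + i√3/6`, `−1/2 + i√3/6`, `−i√3/3`. [folklore] -/
theorem hexCenter_sub_up (x : Site 2) :
    hexCenter ((x, 1) : HexVertex) - hexCenter (x, 0) = ⟨1 / 2, Real.sqrt 3 / 6⟩ ∧
    hexCenter ((x - Pi.single 0 1, 1) : HexVertex) - hexCenter (x, 0) = ⟨-(1 / 2), Real.sqrt 3 / 6⟩ ∧
    hexCenter ((x - Pi.single 1 1, 1) : HexVertex) - hexCenter (x, 0) = ⟨0, -(Real.sqrt 3 / 3)⟩ := by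
  refine ⟨?_, ?_, ?_⟩ <;> apply Complex.ext <;> simp [hexCenter, triEmbed] <;> ring

/-- **Edge vectors at a down face** `(x; 1)`, in real and imaginary parts: towards `(x; 0)`,
`(x + e₀; 0)`, `(x + e₁; 0)` they are `−1/2 − i√3/6`, `1/2 − i√3/6`, `i√3/3`. [folklore] -/
theorem hexCenter_sub_down (x : Site 2) :
    hexCenter ((x, 0) : HexVertex) - hexCenter (x, 1) = ⟨-(1 / 2), -(Real.sqrt 3 / 6)⟩ ∧
    hexCenter ((x + Pi.single 0 1, 0) : HexVertex) - hexCenter (x, 1) = ⟨1 / 2, -(Real.sqrt 3 / 6)⟩ ∧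
    hexCenter ((x + Pi.single 1 1, 0) : HexVertex) - hexCenter (x, 1) = ⟨0, Real.sqrt 3 / 3⟩ := by
  refine ⟨?_, ?_, ?_⟩ <;> apply Complex.ext <;> simp [hexCenter, triEmbed] <;> ring

/-! ### 4. Single-class dangling edges of the six zigzag half-lattices -/

/-- **Single-class dangling edges of the six exact zigzag half-lattices** (registered helper
`zigzag_dangling_direction` of crux stmt-CriticalPhenomena-14004, line `polygon-parity-squeeze`).
For every form `k : Fin 6`, threshold `n` and edge `{v, w}` of `ℍ` with `v` in the half-lattice
`{v | n ≤ zigzagForm k v}` and `w` outside it, the embedded edge vector is the SAME: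
`c_w − c_v = −(1/√3)·innerNormal k` (outward, length `1/√3` = the edge length of the embedded
honeycomb).  Finite check: `w` is one of the three neighbours of `v = (x; t)`; for each form exactly
one of the six (type, neighbour) pairs is compatible with the two threshold conditions, and its edge
vector is the stated one. [folklore] -/
theorem zigzag_dangling_direction : ∀ (k : Fin 6) (n : ℤ) (v w : HexVertex), hexGraph.Adj v w → n ≤ zigzagForm k v → ¬ n ≤ zigzagForm k w → hexCenter w - hexCenter v = -(((Real.sqrt 3)⁻¹ : ℝ) : ℂ) * innerNormal k := by
  rintro k n ⟨x, t⟩ ⟨y, s⟩ hadj hv hw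
  fin_cases t <;> fin_cases s
  · exact absurd hadj (not_hexGraph_adj_of_snd_eq_holds _ _ rfl)
  · obtain ⟨eA, eB, eC⟩ := hexCenter_sub_up x
    rcases (hexGraph_adj_iff_of_snd_eq_zero_holds x y).1 hadj with rfl | rfl | rfl <;> fin_cases k <;>
      simp [zigzagForm] at hv hw <;>
      first | omega | (rw [neg_inv_sqrt_three_mul_innerNormal]; simp [eA, eB, eC])
  · obtain ⟨eA, eB, eC⟩ := hexCenter_sub_down x
    rcases (hexGraph_adj_iff_of_snd_eq_one x y).1 hadj with rfl | rfl | rfl <;> fin_cases k <;>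
      simp [zigzagForm] at hv hw <;>
      first | omega | (rw [neg_inv_sqrt_three_mul_innerNormal]; simp [eA, eB, eC])
  · exact absurd hadj (not_hexGraph_adj_of_snd_eq_holds _ _ rfl)

/-- **No down face dangles from a half-lattice of form `0`** (a companion used when enumerating the
boundary mid-edges of a flat side of form `0`: they all hang from UP faces of the threshold row).
[folklore] -/
theorem not_dangling_zero_of_snd_eq_one (n : ℤ) (x : Site 2) (w : HexVertex)
    (hadj : hexGraph.Adj ((x, 1) : HexVertex) w) (hv : n ≤ zigzagForm 0 (x, 1)) :
    n ≤ zigzagForm 0 w := by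
  obtain ⟨y, s⟩ := w
  fin_cases s
  · rcases (hexGraph_adj_iff_of_snd_eq_one x y).1 hadj with rfl | rfl | rfl <;>
      simp [zigzagForm] at hv ⊢ <;> omega
  · exact absurd hadj (not_hexGraph_adj_of_snd_eq_holds _ _ rfl)

/-- **The dangling edges of form `0` hang from the threshold row**: if `{v, w}` leaves the
half-lattice `{v | n ≤ v.1 1}` at `v`, then `v = (x; 0)` is an up face of row `n` and
`w = (x − e₁; 1)` is the down face below it. [folklore] -/
theorem dangling_zero_eq (n : ℤ) (v w : HexVertex) (hadj : hexGraph.Adj v w)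
    (hv : n ≤ zigzagForm 0 v) (hw : ¬ n ≤ zigzagForm 0 w) :
    v.2 = 0 ∧ v.1 1 = n ∧ w = (v.1 - Pi.single 1 1, 1) := by
  obtain ⟨x, t⟩ := v
  obtain ⟨y, s⟩ := w
  fin_cases t <;> fin_cases s
  · exact absurd hadj (not_hexGraph_adj_of_snd_eq_holds _ _ rfl)
  · rcases (hexGraph_adj_iff_of_snd_eq_zero_holds x y).1 hadj with rfl | rfl | rfl <;>
      simp [zigzagForm] at hv hw ⊢ <;> omega
  · rcases (hexGraph_adj_iff_of_snd_eq_one x y).1 hadj with rfl | rfl | rfl <;>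
      simp [zigzagForm] at hv hw <;> omega
  · exact absurd hadj (not_hexGraph_adj_of_snd_eq_holds _ _ rfl)

end Summit.CriticalPhenomena.SAWScalingLimit.Theorems.PolygonParitySqueeze

end
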